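import Literature.Geometry.Lorentzian.NormalExpJacobi
import Literature.Geometry.Lorentzian.NullScreenAlgebra
import Literature.Geometry.Lorentzian.NullFocusingODE
import Literature.Geometry.Lorentzian.FutureNullCompleteness
import Literature.Geometry.Lorentzian.SecondFundamentalFormSymm
import Literature.Geometry.Lorentzian.SecondFundamentalFormApply
import HarnessLib

/-!
# The null focusing theorem: existence of focal points along null normal geodesics

Layer L4 of the proof programme of `Literature.Geometry.Lorentzian.ChruscielEtAl2001_areaTheorem`
(Chruściel–Delay–Galloway–Howard 2001, Prop. 4.17: "By well known results [O'Neill], `S` has a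
focal point along `Γ` at finite affine distance") and the focusing half of "half 2" of the
Penrose singularity theorem (`PenroseSingularityTheoremProofs.lean`; Hawking–Ellis 1973,
Prop. 4.4.6; O'Neill 1983, Ch. 10, Prop. 43). Main result:

* `exists_not_injective_mfderiv_normalExp_of_nullExpansion_neg` — **the null focusing theorem**:
  for a map `f : N → M` into a Lorentzian manifold and a `C^∞` **null normal** field `L` along
  `f`, a point `z` with `df_z(w₁), …, df_z(w_m)` orthonormal (`m + 2 = dim M`) and null expansion
  `θ₀ = ∑ᵢ g(D_{wᵢ}L, df wᵢ) < 0` (the trace of the null second fundamental form, the tree's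
  `nullExpansion`), if the null normal geodesic `γ(t) = exp_{f z}(t L z)` exists on `[0, m/|θ₀|]`
  and `Ric(γ̇, γ̇) ≥ 0` along it (null energy condition), then the normal exponential map
  `E(z', t) = exp_{f z'}(t L z')` has NON-injective differential at `(z, t)` for some
  `t ∈ (0, m/|θ₀|]`: `γ(t)` is a focal point of `f(N)` along `γ` (O'Neill 1983, Ch. 10,
  Prop. 30 (3) with Prop. 43; Hawking–Ellis 1973, Prop. 4.4.6, "within an affine distance
  `2/(-θ̂)`" in dimension `4`).

The proof is the Raychaudhuri (optical Riccati equation) argument of Chruściel–Delay–Galloway–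
Howard 2001, §5, (5.1)–(5.2) / Hawking–Ellis 1973, (4.35), organised frame-free around the Gram
determinant of the screen Jacobi fields:

* `nullJacobi_spec` — the variation fields `J_w(t) = d(E(·, t))_z(w)` of the congruence of null
  normal geodesics are Jacobi fields along `γ`, orthogonal to `γ̇` with their derivatives, with
  `J_w(0) = df_z w`, `D_t J_w(0) = D_w L` (assembled from `NormalExpJacobi.lean`);
* `hasDerivAt_val_covariantDerivAlong_screenFrame` — the Jacobi equation in a parallel screen
  frame ignores the `γ̇`-component (`R(γ̇, γ̇) = 0`);
* `raychaudhuri_gram` — **the Raychaudhuri inequality, pointwise**: for Jacobi fields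
  `J_k ⊥ γ̇` (with `D_t J_k ⊥ γ̇`) along a null geodesic with vanishing pairwise Wronskians and
  `card + 2 = dim M`, wherever the Gram determinant `D = det(g(J_k, J_l))` is nonzero,
  `θ = D'/(2D)` satisfies `θ' + θ²/m + Ric(γ̇, γ̇) ≤ 0`, and `θ = tr(A₁A⁻¹)` in any screen frame —
  via LOCAL parallel orthonormal screen frames (`exists_orthonormal_screen`,
  `exists_parallel_orthonormal_frame_Icc`), `D = (det A)²` (`gram_eq_transpose_mul`),
  `tr R = Ric(γ̇, γ̇)` (`ricci_null_eq_sum_screen`) and the matrix Riccati layer of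
  `NullFocusingODE.lean` / `VolumeSphereTheoremProofs.lean`;
* the assembly: `D(0) = 1`, `θ(0) = θ₀` (frame `df_z(w)`), the Wronskians vanish identically
  (`hasDerivAt_wronskian_of_isJacobiFieldAlongOn` and the symmetry of the null second
  fundamental form, `secondFundamentalForm_symm_holds`), so `D` has a zero `t* ≤ m/|θ₀|`
  (`exists_eq_zero_of_raychaudhuri`), where a nontrivial combination `∑ a_k J_k(t*) = c γ̇(t*)`
  (`exists_sum_smul_eq_smul_null_of_det_gram_eq_zero`) exhibits the kernel vector
  `(∑ a_k w_k, -c)` of `dE_{(z, t*)}` (`mfderiv_normalExp_apply`).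

Stated for a `C^n` Lorentzian metric (`n ≥ 2`, Levi-Civita connection locally `C^∞`) on a
Hausdorff manifold with model `𝓘(ℝ, E)` (boundaryless), a manifold `N` with boundaryless model,
and a general finite index type of cardinality `dim M - 2`; no completeness and no causality
assumption. No definitions, no named facts (D-0026).

## References

* B. O'Neill, *Semi-Riemannian geometry with applications to relativity*, Academic Press 1983,
  Ch. 10, Def. 29, Prop. 30, Cor. 40, Prop. 43 (pp. 282–291).
* S. W. Hawking, G. F. R. Ellis, *The large scale structure of space-time*, CUP 1973, §4.2
  (4.35), §4.4, Props. 4.4.4–4.4.6.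
* P. T. Chruściel, E. Delay, G. J. Galloway, R. Howard, *Regularity of horizons and the area
  theorem*, Ann. Henri Poincaré 2 (2001) 109–178, Prop. 4.17; §5, (5.1)–(5.2).
* G. J. Galloway, *Maximum principles for null hypersurfaces and null splitting theorems*,
  Ann. Henri Poincaré 1 (2000) 543–567, §2.
-/

noncomputable section

open Bundle Set Filter Function
open scoped Manifold ContDiff Topology Matrix

namespace Literature.Geometry.Lorentzian

open Literature.Geometry.Riemannian

universe u

/-! ### The chart-straight curves are smooth near `0` -/

section Curves

variable {E' : Type*} [NormedAddCommGroup E'] [NormedSpace ℝ E'] {H' : Type*} [TopologicalSpace H']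
  {I' : ModelWithCorners ℝ E' H'} [I'.Boundaryless] {N : Type*} [TopologicalSpace N]
  [ChartedSpace H' N] [IsManifold I' ∞ N]

/-- The chart-straight curve `curveThrough I' z w` is `C^∞` at every parameter near `0`
(boundaryless model: the chart target is open and contains the chart image of `z`).
[cite: ONeillSemiRiemannian1983, Ch. 1, Prop. 1.16 (proof)] -/
theorem eventually_contMDiffAt_curveThrough (z : N) (w : TangentSpace I' z) :
    ∀ᶠ s in 𝓝 (0 : ℝ), ContMDiffAt 𝓘(ℝ, ℝ) I' ∞ (curveThrough I' z w) s := by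
  have hcont : Continuous fun s : ℝ ↦ extChartAt I' z z + s • (show E' from w) :=
    continuous_const.add (continuous_id.smul continuous_const)
  have h0 : extChartAt I' z z + (0 : ℝ) • (show E' from w) ∈ (extChartAt I' z).target := by
    simp
  have hev : ∀ᶠ s in 𝓝 (0 : ℝ), extChartAt I' z z + s • (show E' from w) ∈ (extChartAt I' z).target :=
    hcont.continuousAt.preimage_mem_nhds ((isOpen_extChartAt_target z).mem_nhds h0)
  exact hev.mono fun s hs ↦ contMDiffAt_curveThrough z w hs

end Curves

/-! ### The Jacobi fields of the null normal congruence along one generator -/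

section Generator

variable {E : Type u} [NormedAddCommGroup E] [NormedSpace ℝ E] [FiniteDimensional ℝ E]
  [CompleteSpace E] {M : Type*} [TopologicalSpace M] [ChartedSpace E M] [IsManifold 𝓘(ℝ, E) ∞ M]
  [T2Space M]
  {E' : Type*} [NormedAddCommGroup E'] [NormedSpace ℝ E'] [FiniteDimensional ℝ E']
  {H' : Type*} [TopologicalSpace H'] {I' : ModelWithCorners ℝ E' H'} [I'.Boundaryless]
  {N : Type*} [TopologicalSpace N] [ChartedSpace H' N] [IsManifold I' ∞ N]
  {n : ℕ∞ω} [Fact (1 ≤ n)] (g : LorentzianMetric 𝓘(ℝ, E) n M) [g.HasLeviCivita]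
  [CovariantDerivative.ContMDiffCovariantDerivative g.leviCivita 1]
  [CovariantDerivative.ContMDiffCovariantDerivative g.leviCivita (⊤ : ℕ∞)]
  {f : N → M} {L : Π z : N, TangentSpace 𝓘(ℝ, E) (f z)}

omit [FiniteDimensional ℝ E'] in
/-- **The screen Jacobi field `J_w` along the null normal geodesic `γ_z = (t ↦ exp_{f z}(t L z))`**
— the variation field at `s = 0` of `x(t, s) = exp_{f(c s)}(t L(c s))`, `c = curveThrough I' z w`
— is a Jacobi field along `γ_z` at every `t ∈ dom γ_z`, with differentiable lifts of `J_w` and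
`D_t J_w`, orthogonal to `γ̇_z` together with `D_t J_w` (null normal data: `g(L, L) = 0`,
`L ⊥ df`), with `J_w(0) = df_z(w)`, `D_t J_w(0) = D_w L` (`normalDerivAlong`) and
`J_w(t) = d(E(·, t))_z(w)`, `E(z, t) = exp_{f z}(t L z)`. (O'Neill 1983, Ch. 10, Def. 29,
Cor. 40: these are the `P`-Jacobi fields of `P = f(N)` along the normal null geodesic;
Hawking–Ellis 1973, §4.2, the deviation vectors of the null congruence.) Assembled from
`NormalExpJacobi.lean` by substituting `c 0 = z`, `c'(0) = w`.
[cite: ONeillSemiRiemannian1983, Ch. 10, Def. 29 and Cor. 40] [cite: HawkingEllis1973CUP, §4.2] -/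
theorem nullJacobi_spec (hreg : g.leviCivita.IsLocallyContMDiff 1)
    (hL : ContMDiff I' 𝓘(ℝ, E).tangent ∞
      (fun z ↦ (TotalSpace.mk' E (f z) (L z) : TangentBundle 𝓘(ℝ, E) M)))
    (hnull : ∀ z, g.val (f z) (L z) (L z) = 0) (hLn : g.IsNormalTo I' f L) (z : N)
    (w : TangentSpace I' z) {t : ℝ} (ht : t ∈ maximalGeodesicDomain g.leviCivita (f z) (L z)) :
    let γ : ℝ → M := fun t ↦ expMap g.leviCivita (f z) (t • L z)
    let J : Π t : ℝ, TangentSpace 𝓘(ℝ, E) (γ t) := fun t ↦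
      velocity 𝓘(ℝ, E) (fun s ↦ expMap g.leviCivita (f (curveThrough I' z w s))
        (t • L (curveThrough I' z w s))) 0
    IsJacobiFieldAlongOn g.toPseudoRiemannianMetric γ J {t} ∧
    MDifferentiableAt 𝓘(ℝ, ℝ) 𝓘(ℝ, E).tangent
      (fun t ↦ (TotalSpace.mk' E (γ t) (J t) : TangentBundle 𝓘(ℝ, E) M)) t ∧
    MDifferentiableAt 𝓘(ℝ, ℝ) 𝓘(ℝ, E).tangent (fun t ↦ (TotalSpace.mk' E (γ t)
      (covariantDerivAlong g.leviCivita γ J t) : TangentBundle 𝓘(ℝ, E) M)) t ∧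
    g.val (γ t) (J t) (velocity 𝓘(ℝ, E) γ t) = 0 ∧
    g.val (γ t) (covariantDerivAlong g.leviCivita γ J t) (velocity 𝓘(ℝ, E) γ t) = 0 ∧
    J 0 = mfderiv I' 𝓘(ℝ, E) f z w ∧
    (covariantDerivAlong g.leviCivita γ J 0 : E) = g.normalDerivAlong f L z w ∧
    J t = mfderiv I' 𝓘(ℝ, E) (fun z' ↦ expMap g.leviCivita (f z') (t • L z')) z w := by
  intro γ J
  set c : ℝ → N := curveThrough I' z w with hc_def
  have hc0 : c 0 = z := curveThrough_zero I' z w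
  have hcv : velocity I' c 0 = w :=
    velocity_curveThrough_zero_holds (I := I') BoundarylessManifold.isInteriorPoint w
  have hc : ∀ᶠ s in 𝓝 (0 : ℝ), ContMDiffAt 𝓘(ℝ, ℝ) I' ∞ c s :=
    eventually_contMDiffAt_curveThrough z w
  have hcd : MDifferentiableAt 𝓘(ℝ, ℝ) I' c 0 := (hc.self_of_nhds).mdifferentiableAt (by simp)
  -- the presentation `γ` of the normal geodesic through `c 0 = z`
  have hγ : (fun t ↦ expMap g.leviCivita (f (c 0)) (t • L (c 0))) = γ := by
    rw [hc0]
  have ht' : t ∈ maximalGeodesicDomain g.leviCivita (f (c 0)) (L (c 0)) := by rw [hc0]; exact ht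
  have h0' : (0 : ℝ) ∈ maximalGeodesicDomain g.leviCivita (f (c 0)) (L (c 0)) :=
    (maximalGeodesic_spec' (cov := g.leviCivita) (f (c 0)) (L (c 0))).2.1
  -- the Jacobi package along `γ`
  obtain ⟨hjac, -, hJd, hDJd⟩ := normalExpVariation_jacobi_of_eq g.toPseudoRiemannianMetric
    (ι := f) (ν := L) hreg hL hc ht' hγ
  obtain ⟨-, hsymm0, -, -⟩ := normalExpVariation_jacobi_of_eq g.toPseudoRiemannianMetric
    (ι := f) (ν := L) hreg hL hc h0' hγ
  -- normality
  have hνν : ∀ᶠ s in 𝓝 (0 : ℝ), g.val (f (c s)) (L (c s)) (L (c s)) =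
      g.val (f (c 0)) (L (c 0)) (L (c 0)) := Eventually.of_forall fun s ↦ by
    rw [hnull, hnull]
  have hperp : g.val (f (c 0)) (velocity 𝓘(ℝ, E) (f ∘ c) 0) (L (c 0)) = 0 := by
    have hfd : MDifferentiableAt I' 𝓘(ℝ, E) f (c 0) :=
      ((contMDiff_proj (TangentSpace 𝓘(ℝ, E) : M → Type _) (n := ∞)).comp hL (c 0)
        |>.mdifferentiableAt (by simp))
    rw [velocity_comp hfd hcd, g.symm]
    exact hLn (c 0) (velocity I' c 0)
  obtain ⟨hJn, hDJn⟩ := val_jacobi_velocity_eq_zero_of_normal_of_eq g.toPseudoRiemannianMetric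
    (ι := f) (ν := L) hreg hL hc hνν hperp ht' hγ
  refine ⟨fun t' ht'' ↦ ?_, hJd, hDJd, hJn, hDJn, ?_, ?_, ?_⟩
  · rw [mem_singleton_iff] at ht''
    subst ht''
    exact hjac
  · -- `J 0 = df_z w`
    have h1 : J 0 = velocity 𝓘(ℝ, E) (f ∘ c) 0 :=
      velocity_normalExpVariation_zero (cov := g.leviCivita) (ι := f) (ν := L) c 0
    have hfd : MDifferentiableAt I' 𝓘(ℝ, E) f (c 0) :=
      ((contMDiff_proj (TangentSpace 𝓘(ℝ, E) : M → Type _) (n := ∞)).comp hL (c 0)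
        |>.mdifferentiableAt (by simp))
    rw [h1, velocity_comp hfd hcd, hcv, hc0]
  · -- `D_t J 0 = D_w L`
    have h := covariantDerivAlong_normalExpVariation_zero_of_eq g.toPseudoRiemannianMetric
      (ι := f) (ν := L) c 0 hsymm0
    exact h
  · -- `J t = d(E(·, t))_z w`
    have h := velocity_normalExpVariation_eq_mfderiv (cov := g.leviCivita) (ι := f) (ν := L) hL
      hcd ht'
    rw [hcv, hc0] at h
    exact h

end Generator

/-! ### The Raychaudhuri inequality for the Gram determinant of the screen Jacobi fields -/

section Raychaudhuri

variable {E : Type u} [NormedAddCommGroup E] [NormedSpace ℝ E] [FiniteDimensional ℝ E]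
  [CompleteSpace E] {M : Type*} [TopologicalSpace M] [ChartedSpace E M] [IsManifold 𝓘(ℝ, E) ∞ M]
  {n : ℕ∞ω} [Fact (1 ≤ n)] (g : LorentzianMetric 𝓘(ℝ, E) n M) [g.HasLeviCivita]

/-- **The Jacobi equation in a parallel screen frame** (null variant of
`hasDerivAt_val_covariantDerivAlong_frame_of_expansion`): if the Jacobi field `J` expands as
`J(t) = ∑ⱼ g(J, eⱼ) eⱼ + c γ̇` in fields `eⱼ` parallel on `s ∋ t`, then
`(d/dt) g(D_t J, eᵢ)(t) = -∑ⱼ g(R(eⱼ, γ̇)γ̇, eᵢ) g(J, eⱼ)` — the `γ̇`-component is invisible since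
`R(γ̇, γ̇) = 0`. This is the screen ("optical") form of the Jacobi equation behind the Riccati
equation `b' + b² + R = 0` of the null Weingarten map (Chruściel–Delay–Galloway–Howard 2001, §5,
(5.1); Galloway 2000, §2). [cite: ChruscielEtAl2001, §5, (5.1)] [cite: Galloway2000, §2] -/
theorem hasDerivAt_val_covariantDerivAlong_screenFrame {ι : Type*} [Fintype ι] {γ : ℝ → M}
    {J : Π t : ℝ, TangentSpace 𝓘(ℝ, E) (γ t)} {e : ι → Π t : ℝ, TangentSpace 𝓘(ℝ, E) (γ t)}
    {s : Set ℝ} {t : ℝ} (hJ : IsJacobiFieldAlongOn g.toPseudoRiemannianMetric γ J s)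
    (hDJ : MDifferentiableAt 𝓘(ℝ, ℝ) 𝓘(ℝ, E).tangent
      (fun t ↦ (TotalSpace.mk' E (γ t) (covariantDerivAlong g.leviCivita γ J t) :
        TangentBundle 𝓘(ℝ, E) M)) t)
    (he : ∀ i, IsParallelAlongOn g.leviCivita γ (e i) s) (ht : t ∈ s) {c : ℝ}
    (hexp : J t = ∑ j, g.val (γ t) (J t) (e j t) • e j t + c • velocity 𝓘(ℝ, E) γ t) (i : ι) :
    HasDerivAt (fun t ↦ g.val (γ t) (covariantDerivAlong g.leviCivita γ J t) (e i t))
      (-∑ j, g.val (γ t) (g.leviCivita.curvature (γ t) (e j t) (velocity 𝓘(ℝ, E) γ t)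
        (velocity 𝓘(ℝ, E) γ t)) (e i t) * g.val (γ t) (J t) (e j t)) t := by
  have h := hasDerivAt_val_covariantDerivAlong_of_isJacobiFieldAlongOn g.toPseudoRiemannianMetric
    hJ hDJ (he i) ht
  have hR : g.val (γ t) (g.leviCivita.curvature (γ t) (J t) (velocity 𝓘(ℝ, E) γ t)
      (velocity 𝓘(ℝ, E) γ t)) (e i t) = ∑ j, g.val (γ t) (g.leviCivita.curvature (γ t) (e j t)
        (velocity 𝓘(ℝ, E) γ t) (velocity 𝓘(ℝ, E) γ t)) (e i t) * g.val (γ t) (J t) (e j t) := by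
    conv_lhs => rw [hexp]
    simp only [map_add, map_sum, map_smul, FunLike.coe_sum, FunLike.coe_smul, Finset.sum_apply,
      Pi.smul_apply, smul_eq_mul, add_apply]
    rw [val_curvature_self_dir g.toPseudoRiemannianMetric g.leviCivita (γ t)
      (velocity 𝓘(ℝ, E) γ t) (e i t), mul_zero, add_zero]
    exact Finset.sum_congr rfl fun j _ ↦ by ring
  rw [hR] at h
  exact h

/-- **The Raychaudhuri inequality, pointwise and frame-free.** Let `γ` be a geodesic of the
Levi-Civita connection on the open interval `D₀` with null, nowhere vanishing velocity, and let
`J_k`, `k ∈ ι` with `card ι + 2 = dim M`, be Jacobi fields on `D₀` (differentiable lifts of `J_k`,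
`D_t J_k`) which, together with their derivatives, are orthogonal to `γ̇`, and whose pairwise
Wronskians vanish, `g(D_t J_k, J_l) = g(J_k, D_t J_l)` on `D₀`. Let `D(t) = det (g(J_k, J_l))` be
their Gram determinant and `θ = D'/(2D)`. If `D(t) ≠ 0` at `t ∈ D₀` then `θ` is differentiable
at `t` with `θ' + θ²/card ι + Ric(γ̇, γ̇)(t) ≤ 0`; moreover, for ANY orthonormal screen frame
`v` at `γ t` (`g(vᵢ, vⱼ) = δᵢⱼ`, `vᵢ ⊥ γ̇(t)`), `θ(t) = tr (A₁ A⁻¹)` with `A = (g(J_k(t), vᵢ))`,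
`A₁ = (g(D_t J_k(t), vᵢ))`. Proof: transport `v` to a parallel screen frame on a chart interval
around `t` (`exists_parallel_orthonormal_frame_Icc`); in it `D = (det A)²`
(`gram_eq_transpose_mul`), `A' = A₁`, `A₁' = -R A` with `tr R = Ric(γ̇, γ̇)`
(`ricci_null_eq_sum_screen`) and vanishing matrix Wronskian, so the matrix Riccati layer
(`exists_hasDerivAt_logDeriv_gram_le`) applies. This is the Raychaudhuri equation
`θ' = -Ric(γ̇,γ̇) - σ² - θ²/(n-2)` of the null congruence in inequality form (Hawking–Ellis 1973,
(4.35); Chruściel–Delay–Galloway–Howard 2001, (5.2)).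
[cite: HawkingEllis1973CUP, §4.2, (4.35)] [cite: ChruscielEtAl2001, §5, (5.2)] -/
theorem raychaudhuri_gram (hreg : g.leviCivita.IsLocallyContMDiff ∞)
    (hreg₁ : g.leviCivita.IsLocallyContMDiff 1) (hn : 2 ≤ n)
    {ι : Type*} [Fintype ι] [DecidableEq ι] [Nonempty ι]
    (hcard : Fintype.card ι + 2 = Module.finrank ℝ E) {γ : ℝ → M} {D₀ : Set ℝ} (hD₀ : IsOpen D₀)
    (hgeo : IsGeodesicOn g.leviCivita γ D₀)
    (hnull : ∀ t ∈ D₀, g.val (γ t) (velocity 𝓘(ℝ, E) γ t) (velocity 𝓘(ℝ, E) γ t) = 0)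
    (hne : ∀ t ∈ D₀, velocity 𝓘(ℝ, E) γ t ≠ 0)
    {J : ι → Π t : ℝ, TangentSpace 𝓘(ℝ, E) (γ t)}
    (hJ : ∀ k, IsJacobiFieldAlongOn g.toPseudoRiemannianMetric γ (J k) D₀)
    (hJd : ∀ k, ∀ t ∈ D₀, MDifferentiableAt 𝓘(ℝ, ℝ) 𝓘(ℝ, E).tangent
      (fun t ↦ (TotalSpace.mk' E (γ t) (J k t) : TangentBundle 𝓘(ℝ, E) M)) t)
    (hDJd : ∀ k, ∀ t ∈ D₀, MDifferentiableAt 𝓘(ℝ, ℝ) 𝓘(ℝ, E).tangent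
      (fun t ↦ (TotalSpace.mk' E (γ t) (covariantDerivAlong g.leviCivita γ (J k) t) :
        TangentBundle 𝓘(ℝ, E) M)) t)
    (hJn : ∀ k, ∀ t ∈ D₀, g.val (γ t) (J k t) (velocity 𝓘(ℝ, E) γ t) = 0)
    (hDJn : ∀ k, ∀ t ∈ D₀,
      g.val (γ t) (covariantDerivAlong g.leviCivita γ (J k) t) (velocity 𝓘(ℝ, E) γ t) = 0)
    (hW : ∀ k l, ∀ t ∈ D₀, g.val (γ t) (covariantDerivAlong g.leviCivita γ (J k) t) (J l t) =
      g.val (γ t) (J k t) (covariantDerivAlong g.leviCivita γ (J l) t))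
    {t : ℝ} (ht : t ∈ D₀)
    (hDt : (Matrix.of fun k l ↦ g.val (γ t) (J k t) (J l t)).det ≠ 0)
    {v : ι → TangentSpace 𝓘(ℝ, E) (γ t)}
    (hvon : ∀ i j, g.val (γ t) (v i) (v j) = if i = j then 1 else 0)
    (hvn : ∀ i, g.val (γ t) (v i) (velocity 𝓘(ℝ, E) γ t) = 0) :
    ∃ φ' : ℝ, HasDerivAt (fun s ↦ deriv (fun s ↦ (Matrix.of fun k l ↦ g.val (γ s) (J k s) (J l s)).det) s /
        (2 * (Matrix.of fun k l ↦ g.val (γ s) (J k s) (J l s)).det)) φ' t ∧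
      φ' + (deriv (fun s ↦ (Matrix.of fun k l ↦ g.val (γ s) (J k s) (J l s)).det) t /
        (2 * (Matrix.of fun k l ↦ g.val (γ t) (J k t) (J l t)).det)) ^ 2 / Fintype.card ι +
        g.leviCivita.ricci (γ t) (velocity 𝓘(ℝ, E) γ t) (velocity 𝓘(ℝ, E) γ t) ≤ 0 ∧
      deriv (fun s ↦ (Matrix.of fun k l ↦ g.val (γ s) (J k s) (J l s)).det) t /
        (2 * (Matrix.of fun k l ↦ g.val (γ t) (J k t) (J l t)).det) =
        ((Matrix.of fun i k ↦ g.val (γ t) (covariantDerivAlong g.leviCivita γ (J k) t) (v i)) *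
          (Matrix.of fun i k ↦ g.val (γ t) (J k t) (v i))⁻¹).trace := by
  have hLC := PseudoRiemannianMetric.isLeviCivita_leviCivita_holds (g := g.toPseudoRiemannianMetric)
  have hcompat : g.IsCompatible g.leviCivita := hLC.2
  set G : ℝ → Matrix ι ι ℝ := fun s ↦ Matrix.of fun k l ↦ g.val (γ s) (J k s) (J l s) with hG
  set Dt : ℝ → ℝ := fun s ↦ (Matrix.of fun k l ↦ g.val (γ s) (J k s) (J l s)).det with hDdef
  -- pointwise Lorentzian scalar-product data at `γ s`
  have hB : ∀ s, ∀ u w : E, g.val (γ s) u w = g.val (γ s) w u := fun s u w ↦ g.symm (γ s) u w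
  have hpos : ∀ s, ∀ u w : E, g.val (γ s) u u < 0 → g.val (γ s) u w = 0 → w ≠ 0 →
      0 < g.val (γ s) w w := fun s u w ↦ g.pos_of_orthogonal (γ s) u w
  -- differentiability of `γ` on `D₀`
  have hγdD : ∀ s ∈ D₀, MDifferentiableAt 𝓘(ℝ, ℝ) 𝓘(ℝ, E) γ s := fun s hs ↦
    ((contMDiff_proj (TangentSpace 𝓘(ℝ, E) : M → Type _) (n := 1)).mdifferentiableAt
      one_ne_zero).comp s (hgeo.1 s hs)
  -- a closed chart interval `[a, b] ∋ t` inside `D₀`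
  have hsrc : {s | γ s ∈ (chartAt E (γ t)).source} ∈ 𝓝 t :=
    (hγdD t ht).continuousAt.preimage_mem_nhds
      ((chartAt E (γ t)).open_source.mem_nhds (mem_chart_source E (γ t)))
  obtain ⟨δ₀, hδ₀, hδ₀s⟩ := Metric.mem_nhds_iff.1 (Filter.inter_mem (hD₀.mem_nhds ht) hsrc)
  set δ : ℝ := δ₀ / 2 with hδ
  have hδp : 0 < δ := by rw [hδ]; linarith
  set a : ℝ := t - δ with ha
  set b : ℝ := t + δ with hb
  have hab : a ≤ b := by rw [ha, hb]; linarith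
  have htI : t ∈ Ioo a b := ⟨by rw [ha]; linarith, by rw [hb]; linarith⟩
  have hIccball : Icc a b ⊆ Metric.ball t δ₀ := fun s hs ↦ by
    rw [Metric.mem_ball, Real.dist_eq, abs_lt]
    rw [ha] at hs
    rw [hb] at hs
    constructor <;> linarith [hs.1, hs.2]
  have hD₀sub : Icc a b ⊆ D₀ := fun s hs ↦ (hδ₀s (hIccball hs)).1
  have hγs : ∀ s ∈ Icc a b, γ s ∈ (chartAt E (γ t)).source := fun s hs ↦ (hδ₀s (hIccball hs)).2
  have hγd : ∀ s ∈ Icc a b, MDifferentiableAt 𝓘(ℝ, ℝ) 𝓘(ℝ, E) γ s := fun s hs ↦ hγdD s (hD₀sub hs)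
  have hU : ContinuousOn (fun s ↦ ((trivializationAt E (TangentSpace 𝓘(ℝ, E) : M → Type _) (γ t))
      ⟨γ s, velocity 𝓘(ℝ, E) γ s⟩).2) (Icc a b) := by
    intro s hs
    set tr := trivializationAt E (TangentSpace 𝓘(ℝ, E) : M → Type _) (γ t) with htr
    have hsrc' : (tangentLift 𝓘(ℝ, E) γ s : TangentBundle 𝓘(ℝ, E) M) ∈ tr.source := by
      rw [tr.mem_source]; simpa [htr] using hγs s hs
    have htr_cont : ContinuousAt (fun z : TangentBundle 𝓘(ℝ, E) M ↦ tr z)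
        (tangentLift 𝓘(ℝ, E) γ s) := tr.toOpenPartialHomeomorph.continuousAt hsrc'
    have hlift : ContinuousAt (tangentLift 𝓘(ℝ, E) γ) s := (hgeo.1 s (hD₀sub hs)).continuousAt
    exact (continuousAt_snd.comp (ContinuousAt.comp (f := tangentLift 𝓘(ℝ, E) γ) htr_cont
      hlift)).continuousWithinAt
  -- transport the screen frame `v` to a parallel frame on `(a, b)`
  obtain ⟨e, he0, hepar, heon⟩ := exists_parallel_orthonormal_frame_Icc g.toPseudoRiemannianMetric
    hcompat hreg (γ t) hab hγs hγd hU htI v hvon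
  have hTpar : IsParallelAlongOn g.leviCivita γ (fun s ↦ velocity 𝓘(ℝ, E) γ s) D₀ :=
    IsGeodesicOn.isParallelAlongOn_velocity hgeo
  -- the frame stays orthogonal to `γ̇`
  have hen : ∀ s ∈ Ioo a b, ∀ i, g.val (γ s) (e i s) (velocity 𝓘(ℝ, E) γ s) = 0 := by
    intro s hs i
    set a' := min t s with ha'
    set b' := max t s with hb'
    have hsub : Icc a' b' ⊆ Ioo a b := fun r hr ↦
      ⟨lt_of_lt_of_le (lt_min htI.1 hs.1) hr.1, lt_of_le_of_lt hr.2 (max_lt htI.2 hs.2)⟩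
    have hP : IsParallelAlongOn g.leviCivita γ (e i) (Icc a' b') := fun r hr ↦ hepar i r (hsub hr)
    have hQ : IsParallelAlongOn g.leviCivita γ (fun s ↦ velocity 𝓘(ℝ, E) γ s) (Icc a' b') :=
      fun r hr ↦ hTpar r (hD₀sub (Ioo_subset_Icc_self (hsub hr)))
    have hsI : s ∈ Icc a' b' := ⟨min_le_right _ _, le_max_right _ _⟩
    have htI' : t ∈ Icc a' b' := ⟨min_le_left _ _, le_max_left _ _⟩
    rw [val_apply_eq_of_isParallelAlongOn g.toPseudoRiemannianMetric hcompat hP hQ hsI,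
      ← val_apply_eq_of_isParallelAlongOn g.toPseudoRiemannianMetric hcompat hP hQ htI', he0]
    exact hvn i
  -- expansions of the Jacobi fields in the screen frame
  have hexp : ∀ s ∈ Ioo a b, ∀ k, ∃ c : ℝ,
      J k s = ∑ j, g.val (γ s) (J k s) (e j s) • e j s + c • velocity 𝓘(ℝ, E) γ s := by
    intro s hs k
    obtain ⟨T, hT⟩ := g.exists_timelike (γ s)
    have hsD : s ∈ D₀ := hD₀sub (Ioo_subset_Icc_self hs)
    exact exists_eq_sum_screen_add_smul (V := E) (g.val (γ s)) (hB s) (hpos s) hT (heon s hs)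
      (hnull s hsD) (hne s hsD) (fun i ↦ hen s hs i) hcard (hJn k s hsD)
  choose! cc hcc using hexp
  -- the frame matrices
  set A : ℝ → Matrix ι ι ℝ := fun s ↦ Matrix.of fun i k ↦ g.val (γ s) (J k s) (e i s) with hA
  set A₁ : ℝ → Matrix ι ι ℝ := fun s ↦ Matrix.of fun i k ↦
    g.val (γ s) (covariantDerivAlong g.leviCivita γ (J k) s) (e i s) with hA₁
  set R : ℝ → Matrix ι ι ℝ := fun s ↦ Matrix.of fun i j ↦ g.val (γ s)
    (g.leviCivita.curvature (γ s) (e j s) (velocity 𝓘(ℝ, E) γ s) (velocity 𝓘(ℝ, E) γ s)) (e i s)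
    with hR
  have hAd : ∀ s ∈ Ioo a b, HasDerivAt A (A₁ s) s := fun s hs ↦ by
    refine hasDerivAt_pi.2 fun i ↦ hasDerivAt_pi.2 fun k ↦ ?_
    simp only [hA, hA₁, Matrix.of_apply]
    exact hasDerivAt_val_apply_of_isParallelAlongOn g.toPseudoRiemannianMetric hcompat
      (hJd k s (hD₀sub (Ioo_subset_Icc_self hs))) (hepar i) hs
  have hA₁d : HasDerivAt A₁ (-(R t * A t)) t := by
    refine hasDerivAt_pi.2 fun i ↦ hasDerivAt_pi.2 fun k ↦ ?_
    simp only [hA, hA₁, hR, Matrix.of_apply, Matrix.neg_apply, Matrix.mul_apply]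
    exact hasDerivAt_val_covariantDerivAlong_screenFrame g
      (fun s hs ↦ hJ k s (hD₀sub (Ioo_subset_Icc_self hs))) (hDJd k t ht) hepar htI (hcc t htI k) i
  -- `G = Aᵀ A` on `(a, b)`
  have hGA : ∀ s ∈ Ioo a b, G s = (A s)ᵀ * A s := fun s hs ↦
    gram_eq_transpose_mul (V := E) (g.val (γ s)) (e := fun i ↦ e i s) (ℓ := velocity 𝓘(ℝ, E) γ s)
      (J := fun k ↦ J k s) (c := cc s) (fun k ↦ hJn k s (hD₀sub (Ioo_subset_Icc_self hs)))
      (fun k ↦ hcc s hs k)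
  have hDev : ∀ᶠ s in 𝓝 t, Dt s = ((A s)ᵀ * A s).det := by
    filter_upwards [isOpen_Ioo.mem_nhds htI] with s hs
    show (G s).det = _
    rw [hGA s hs]
  have hAev : ∀ᶠ s in 𝓝 t, HasDerivAt A (A₁ s) s := by
    filter_upwards [isOpen_Ioo.mem_nhds htI] with s hs
    exact hAd s hs
  have hdetA : (A t).det ≠ 0 := by
    intro h0
    apply hDt
    show (G t).det = 0
    rw [hGA t htI, Matrix.det_mul, Matrix.det_transpose, h0, mul_zero]
  -- the matrix Wronskian vanishes
  have hWm : (A₁ t)ᵀ * A t = (A t)ᵀ * A₁ t := by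
    ext k l
    simp only [Matrix.mul_apply, Matrix.transpose_apply, hA, hA₁, Matrix.of_apply]
    have h1 : ∑ i, g.val (γ t) (covariantDerivAlong g.leviCivita γ (J k) t) (e i t) *
        g.val (γ t) (J l t) (e i t) =
        g.val (γ t) (covariantDerivAlong g.leviCivita γ (J k) t) (J l t) := by
      conv_rhs => rw [hcc t htI l]
      simp only [map_add, map_sum, map_smul, smul_eq_mul, hDJn k t ht, mul_zero, add_zero]
      exact Finset.sum_congr rfl fun i _ ↦ by ring
    have h2 : ∑ i, g.val (γ t) (J k t) (e i t) *
        g.val (γ t) (covariantDerivAlong g.leviCivita γ (J l) t) (e i t) =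
        g.val (γ t) (J k t) (covariantDerivAlong g.leviCivita γ (J l) t) := by
      rw [hB t (J k t)]
      conv_rhs => rw [hcc t htI k]
      simp only [map_add, map_sum, map_smul, smul_eq_mul, hDJn l t ht, mul_zero, add_zero]
    rw [h1, h2]
    exact hW k l t ht
  -- the matrix Riccati layer
  obtain ⟨φ', hφ', hle⟩ := exists_hasDerivAt_logDeriv_gram_le (A := A) (A₁ := A₁) (R := R)
    (D := Dt) hAev hA₁d hdetA hWm hDev
  have htrR : (R t).trace =
      g.leviCivita.ricci (γ t) (velocity 𝓘(ℝ, E) γ t) (velocity 𝓘(ℝ, E) γ t) := by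
    simp only [hR, Matrix.trace, Matrix.diag_apply, Matrix.of_apply]
    exact (ricci_null_eq_sum_screen g hcompat hreg₁ hn (γ t) (e := fun i ↦ e i t) (heon t htI)
      (hnull t ht) (hne t ht) (fun i ↦ hen t htI i) hcard).symm
  have hval : deriv Dt t / (2 * Dt t) = (A₁ t * (A t)⁻¹).trace := by
    have hDs : HasDerivAt Dt (2 * (A₁ t * (A t)⁻¹).trace * ((A t)ᵀ * A t).det) t :=
      (hasDerivAt_det_transpose_mul_self (hAd t htI) hdetA).congr_of_eventuallyEq hDev
    rw [hDs.deriv, hDev.self_of_nhds]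
    have hne' : ((A t)ᵀ * A t).det ≠ 0 := by
      rw [Matrix.det_mul, Matrix.det_transpose]
      exact mul_ne_zero hdetA hdetA
    field_simp
  have hAt : A t = Matrix.of fun i k ↦ g.val (γ t) (J k t) (v i) := by
    ext i k
    simp only [hA, Matrix.of_apply, he0]
  have hA₁t : A₁ t = Matrix.of fun i k ↦
      g.val (γ t) (covariantDerivAlong g.leviCivita γ (J k) t) (v i) := by
    ext i k
    simp only [hA₁, Matrix.of_apply, he0]
  refine ⟨φ', hφ', ?_, ?_⟩
  · rw [← htrR]
    exact hle
  · rw [hval, hAt, hA₁t]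

end Raychaudhuri

/-! ### The null focusing theorem -/

section Focusing

variable {E : Type u} [NormedAddCommGroup E] [NormedSpace ℝ E] [FiniteDimensional ℝ E]
  [CompleteSpace E] {M : Type*} [TopologicalSpace M] [ChartedSpace E M] [IsManifold 𝓘(ℝ, E) ∞ M]
  [T2Space M]
  {E' : Type*} [NormedAddCommGroup E'] [NormedSpace ℝ E'] [FiniteDimensional ℝ E']
  {H' : Type*} [TopologicalSpace H'] {I' : ModelWithCorners ℝ E' H'} [I'.Boundaryless]
  {N : Type*} [TopologicalSpace N] [ChartedSpace H' N] [IsManifold I' ∞ N]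
  {n : ℕ∞ω} [Fact (1 ≤ n)] (g : LorentzianMetric 𝓘(ℝ, E) n M) [g.HasLeviCivita]
  [CovariantDerivative.ContMDiffCovariantDerivative g.leviCivita 1]
  [CovariantDerivative.ContMDiffCovariantDerivative g.leviCivita (⊤ : ℕ∞)]
  {f : N → M} {L : Π z : N, TangentSpace 𝓘(ℝ, E) (f z)}

/-- **The null focusing theorem: existence of focal points along null normal geodesics**
(O'Neill 1983, Ch. 10, Prop. 43, in the form of Prop. 30 (3); Hawking–Ellis 1973, §4.4,
Prop. 4.4.6; the "well known results" invoked by Chruściel–Delay–Galloway–Howard 2001, Prop. 4.17,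
and by the proof of the Penrose singularity theorem). Let `f : N → M` be a map into the
Lorentzian manifold `(M, g)` (Levi-Civita connection locally `C^∞`, metric `C^n`, `n ≥ 2`) and `L`
a field along `f` with `z ↦ (f z, L z) ∈ TM` of class `C^∞`, **null** (`g(L, L) = 0`, `L ≠ 0`) and
**normal** to `f`; let `z ∈ N` and `w₁, …, w_m ∈ T_zN` with `df_z(wᵢ)` `g`-orthonormal, where
`m + 2 = dim M` (so `f` is a spacelike immersion of codimension two near `z`); let
`θ₀ = ∑ᵢ g(D_{wᵢ} L, df_z wᵢ) = tr χ_L(z)` be the null expansion of `f` at `z` with respect to `L`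
(`nullExpansion`). If `θ₀ < 0`, the null normal geodesic `γ(t) = exp_{f z}(t L z)` is defined on
`[0, m/|θ₀|]`, and `Ric(γ̇, γ̇) ≥ 0` at its points of nonnegative parameter (null energy condition),
then for some `t ∈ (0, m/|θ₀|]` the differential at `(z, t)` of the normal exponential map
`E(z', t') = exp_{f z'}(t' L z')` is NOT injective — `γ(t)` is a focal point of `f` along `γ`.
Proof (Raychaudhuri route, CDGH 2001 §5 / Hawking–Ellis (4.35)): the Gram determinant `D` of the
screen Jacobi fields `J_k = d(E(·, t))_z w_k` (`nullJacobi_spec`) has `D(0) = 1`, its logarithmic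
half-derivative `θ = D'/(2D)` starts at `θ(0) = θ₀` and satisfies `θ' ≤ -θ²/m` wherever `D ≠ 0`
(`raychaudhuri_gram` + NEC), so `D` vanishes at some `t* ≤ m/|θ₀|` (`exists_eq_zero_of_raychaudhuri`);
there a nontrivial combination `∑ a_k J_k(t*)` is a multiple `c γ̇(t*)` of the null generator
(`exists_sum_smul_eq_smul_null_of_det_gram_eq_zero`), i.e. `dE_{(z,t*)}(∑ a_k w_k, -c) = 0`
(`mfderiv_normalExp_apply`). [cite: ONeillSemiRiemannian1983, Ch. 10, Prop. 43 and Prop. 30]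
[cite: HawkingEllis1973CUP, §4.4, Prop. 4.4.6] [cite: ChruscielEtAl2001, Prop. 4.17 and §5, (5.2)] -/
theorem exists_not_injective_mfderiv_normalExp_of_nullExpansion_neg
    (hreg : g.leviCivita.IsLocallyContMDiff ∞) (hreg₁ : g.leviCivita.IsLocallyContMDiff 1)
    (hn : 2 ≤ n)
    (hL : ContMDiff I' 𝓘(ℝ, E).tangent ∞
      (fun z ↦ (TotalSpace.mk' E (f z) (L z) : TangentBundle 𝓘(ℝ, E) M)))
    (hnull : ∀ z, g.val (f z) (L z) (L z) = 0) (hL0 : ∀ z, L z ≠ 0) (hLn : g.IsNormalTo I' f L)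
    {ι : Type*} [Fintype ι] [DecidableEq ι] [Nonempty ι]
    (hcard : Fintype.card ι + 2 = Module.finrank ℝ E) {z : N} (w : ι → TangentSpace I' z)
    (hw : ∀ i j, g.val (f z) (mfderiv I' 𝓘(ℝ, E) f z (w i)) (mfderiv I' 𝓘(ℝ, E) f z (w j)) =
      if i = j then 1 else 0)
    {θ₀ : ℝ} (hθ₀ : ∑ i, g.val (f z) (g.normalDerivAlong f L z (w i))
      (mfderiv I' 𝓘(ℝ, E) f z (w i)) = θ₀) (hneg : θ₀ < 0)
    (hNEC : ∀ t ∈ maximalGeodesicDomain g.leviCivita (f z) (L z), 0 ≤ t →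
      0 ≤ g.leviCivita.ricci (expMap g.leviCivita (f z) (t • L z))
        (velocity 𝓘(ℝ, E) (fun t : ℝ ↦ expMap g.leviCivita (f z) (t • L z)) t)
        (velocity 𝓘(ℝ, E) (fun t : ℝ ↦ expMap g.leviCivita (f z) (t • L z)) t))
    (hdom : Icc 0 (Fintype.card ι / (-θ₀)) ⊆ maximalGeodesicDomain g.leviCivita (f z) (L z)) :
    ∃ t ∈ Ioc 0 (Fintype.card ι / (-θ₀)), ¬ Injective (mfderiv (I'.prod 𝓘(ℝ, ℝ)) 𝓘(ℝ, E)
      (fun q : N × ℝ ↦ expMap g.leviCivita (f q.1) (q.2 • L q.1)) (z, t)) := by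
  have hLC := PseudoRiemannianMetric.isLeviCivita_leviCivita_holds (g := g.toPseudoRiemannianMetric)
  have hcompat : g.IsCompatible g.leviCivita := hLC.2
  set γ : ℝ → M := fun t : ℝ ↦ expMap g.leviCivita (f z) (t • L z) with hγ
  set D₀ : Set ℝ := maximalGeodesicDomain g.leviCivita (f z) (L z) with hD₀
  obtain ⟨hmax, h0, -, -⟩ := maximalGeodesic_spec' (cov := g.leviCivita) (f z) (L z)
  have hD₀o : IsOpen D₀ := hmax.isOpen
  have hD₀c : D₀.OrdConnected := hmax.2.1
  have hgeo : IsGeodesicOn g.leviCivita γ D₀ := isGeodesicOn_expMap_smul (cov := g.leviCivita) (f z) (L z)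
  -- pointwise Lorentzian scalar-product data
  have hB : ∀ s, ∀ u u' : E, g.val (γ s) u u' = g.val (γ s) u' u := fun s u u' ↦ g.symm (γ s) u u'
  have hpos : ∀ s, ∀ u u' : E, g.val (γ s) u u < 0 → g.val (γ s) u u' = 0 → u' ≠ 0 →
      0 < g.val (γ s) u' u' := fun s u u' ↦ g.pos_of_orthogonal (γ s) u u'
  -- the velocity is null and nowhere zero
  have hv0 : velocity 𝓘(ℝ, E) γ 0 = L z := velocity_expMap_smul_zero (cov := g.leviCivita) (f z) (L z)
  have hγ0 : γ 0 = f z := by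
    show expMap g.leviCivita (f z) ((0 : ℝ) • L z) = f z
    rw [zero_smul]
    exact expMap_zero (cov := g.leviCivita) (f z)
  have hnullγ : ∀ t ∈ D₀, g.val (γ t) (velocity 𝓘(ℝ, E) γ t) (velocity 𝓘(ℝ, E) γ t) = 0 := by
    intro t ht
    have h := g.toPseudoRiemannianMetric.val_velocity_eq_of_isGeodesicOn_holds hD₀o hD₀c hgeo ht h0
    rw [hv0, hγ0] at h
    rw [h]
    exact hnull z
  have hneγ : ∀ t ∈ D₀, velocity 𝓘(ℝ, E) γ t ≠ 0 := fun t ht ↦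
    IsGeodesicOn.velocity_ne_zero (cov := g.leviCivita) hD₀o hD₀c hgeo h0
      (by rw [hv0]; exact hL0 z) ht
  -- the screen Jacobi fields
  set J : ι → Π t : ℝ, TangentSpace 𝓘(ℝ, E) (γ t) := fun k t ↦
    velocity 𝓘(ℝ, E) (fun s ↦ expMap g.leviCivita (f (curveThrough I' z (w k) s))
      (t • L (curveThrough I' z (w k) s))) 0 with hJdef
  have hspec : ∀ k, ∀ t ∈ D₀,
      IsJacobiFieldAlongOn g.toPseudoRiemannianMetric γ (J k) {t} ∧
      MDifferentiableAt 𝓘(ℝ, ℝ) 𝓘(ℝ, E).tangent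
        (fun t ↦ (TotalSpace.mk' E (γ t) (J k t) : TangentBundle 𝓘(ℝ, E) M)) t ∧
      MDifferentiableAt 𝓘(ℝ, ℝ) 𝓘(ℝ, E).tangent (fun t ↦ (TotalSpace.mk' E (γ t)
        (covariantDerivAlong g.leviCivita γ (J k) t) : TangentBundle 𝓘(ℝ, E) M)) t ∧
      g.val (γ t) (J k t) (velocity 𝓘(ℝ, E) γ t) = 0 ∧
      g.val (γ t) (covariantDerivAlong g.leviCivita γ (J k) t) (velocity 𝓘(ℝ, E) γ t) = 0 ∧
      J k 0 = mfderiv I' 𝓘(ℝ, E) f z (w k) ∧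
      (covariantDerivAlong g.leviCivita γ (J k) 0 : E) = g.normalDerivAlong f L z (w k) ∧
      J k t = mfderiv I' 𝓘(ℝ, E) (fun z' ↦ expMap g.leviCivita (f z') (t • L z')) z (w k) :=
    fun k t ht ↦ nullJacobi_spec g hreg₁ hL hnull hLn z (w k) ht
  have hJ : ∀ k, IsJacobiFieldAlongOn g.toPseudoRiemannianMetric γ (J k) D₀ :=
    fun k t ht ↦ (hspec k t ht).1 t (mem_singleton t)
  have hJd := fun k t (ht : t ∈ D₀) ↦ (hspec k t ht).2.1
  have hDJd := fun k t (ht : t ∈ D₀) ↦ (hspec k t ht).2.2.1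
  have hJn := fun k t (ht : t ∈ D₀) ↦ (hspec k t ht).2.2.2.1
  have hDJn := fun k t (ht : t ∈ D₀) ↦ (hspec k t ht).2.2.2.2.1
  have hJ0 : ∀ k, J k 0 = mfderiv I' 𝓘(ℝ, E) f z (w k) := fun k ↦ (hspec k 0 h0).2.2.2.2.2.1
  have hDJ0 : ∀ k, (covariantDerivAlong g.leviCivita γ (J k) 0 : E) = g.normalDerivAlong f L z (w k) :=
    fun k ↦ (hspec k 0 h0).2.2.2.2.2.2.1
  have hJE := fun k t (ht : t ∈ D₀) ↦ (hspec k t ht).2.2.2.2.2.2.2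
  -- symmetry of the null second fundamental form at `z`
  have h2le : (2 : ℕ∞ω) ≤ ∞ := WithTop.coe_le_coe.2 le_top
  have h1le : (1 : ℕ∞ω) ≤ ∞ := WithTop.coe_le_coe.2 le_top
  have hf : ContMDiff I' 𝓘(ℝ, E) 2 f :=
    ((contMDiff_proj (TangentSpace 𝓘(ℝ, E) : M → Type _) (n := ∞)).comp hL).of_le h2le
  have hL1 : ContMDiff I' 𝓘(ℝ, E).tangent 1
      (fun z ↦ (TotalSpace.mk' E (f z) (L z) : TangentBundle 𝓘(ℝ, E) M)) := hL.of_le h1le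
  have hχsymm : ∀ v v' : TangentSpace I' z,
      g.val (f z) (g.normalDerivAlong f L z v) (mfderiv I' 𝓘(ℝ, E) f z v') =
      g.val (f z) (g.normalDerivAlong f L z v') (mfderiv I' 𝓘(ℝ, E) f z v) := by
    intro v v'
    have hsymm := PseudoRiemannianMetric.secondFundamentalForm_symm_holds
      (g := g.toPseudoRiemannianMetric) (I' := I') hf hLn hL1 (y := z)
      BoundarylessManifold.isInteriorPoint
    have happ := fun v v' ↦ PseudoRiemannianMetric.secondFundamentalForm_apply_holds
      (g := g.toPseudoRiemannianMetric) (I' := I') (y := z) BoundarylessManifold.isInteriorPoint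
      ((hL z).mdifferentiableAt (by simp)) v v'
    rw [← happ v v', ← happ v' v]
    exact hsymm.eq v v'
  -- the Wronskians vanish identically
  have hW : ∀ k l, ∀ t ∈ D₀, g.val (γ t) (covariantDerivAlong g.leviCivita γ (J k) t) (J l t) =
      g.val (γ t) (J k t) (covariantDerivAlong g.leviCivita γ (J l) t) := by
    intro k l t ht
    set wr : ℝ → ℝ := fun t ↦ g.val (γ t) (covariantDerivAlong g.leviCivita γ (J k) t) (J l t) -
      g.val (γ t) (J k t) (covariantDerivAlong g.leviCivita γ (J l) t) with hwr
    have hwrd : ∀ s ∈ D₀, HasDerivAt wr 0 s := fun s hs ↦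
      hasDerivAt_wronskian_of_isJacobiFieldAlongOn g.toPseudoRiemannianMetric hreg₁ hn (hJ k) (hJ l)
        hs (hJd k s hs) (hJd l s hs) (hDJd k s hs) (hDJd l s hs)
    have hwrt : wr t = wr 0 := hD₀o.is_const_of_deriv_eq_zero hD₀c.isPreconnected
      (fun s hs ↦ (hwrd s hs).differentiableAt.differentiableWithinAt)
      (fun s hs ↦ (hwrd s hs).deriv) ht h0
    have hwr0 : wr 0 = 0 := by
      simp only [hwr]
      have e1 : g.val (γ 0) (covariantDerivAlong g.leviCivita γ (J k) 0) (J l 0) =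
          g.val (f z) (g.normalDerivAlong f L z (w k)) (mfderiv I' 𝓘(ℝ, E) f z (w l)) := by
        rw [hJ0 l, ← hDJ0 k, hγ0]
      have e2 : g.val (γ 0) (J k 0) (covariantDerivAlong g.leviCivita γ (J l) 0) =
          g.val (f z) (g.normalDerivAlong f L z (w l)) (mfderiv I' 𝓘(ℝ, E) f z (w k)) := by
        rw [g.symm, hJ0 k, ← hDJ0 l, hγ0]
      rw [e1, e2, hχsymm (w k) (w l), sub_self]
    have h := hwrt
    rw [hwr0] at h
    exact sub_eq_zero.1 h
  -- the Gram determinant and the expansion `θ = D'/(2D)`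
  set Dt : ℝ → ℝ := fun s ↦ (Matrix.of fun k l ↦ g.val (γ s) (J k s) (J l s)).det with hDt
  set θ : ℝ → ℝ := fun s ↦ deriv Dt s / (2 * Dt s) with hθ
  have hDcont : ContinuousOn Dt D₀ := fun t ht ↦ by
    have hG : ContinuousAt (fun s ↦ Matrix.of fun k l ↦ g.val (γ s) (J k s) (J l s)) t := by
      refine continuousAt_pi.2 fun k ↦ continuousAt_pi.2 fun l ↦ ?_
      simp only [Matrix.of_apply]
      exact (g.toPseudoRiemannianMetric.hasDerivAt_val_apply_along hcompat (hJd k t ht)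
        (hJd l t ht)).continuousAt
    have hc : Continuous fun A : Matrix ι ι ℝ ↦ A.det := continuous_id.matrix_det
    exact (hc.continuousAt.comp hG).continuousWithinAt
  have hD0 : Dt 0 = 1 := by
    have h1 : (Matrix.of fun k l ↦ g.val (γ 0) (J k 0) (J l 0)) = 1 := by
      ext k l
      rw [Matrix.of_apply, hJ0 k, hJ0 l, hγ0, hw k l, Matrix.one_apply]
    simp only [hDt, h1, Matrix.det_one]
  -- the pointwise Raychaudhuri inequality wherever `D ≠ 0`
  have hcard' : Fintype.card ι = Module.finrank ℝ E - 2 := by omega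
  have hstep : ∀ t ∈ D₀, Dt t ≠ 0 → ∃ φ' : ℝ, HasDerivAt θ φ' t ∧
      φ' + θ t ^ 2 / Fintype.card ι +
        g.leviCivita.ricci (γ t) (velocity 𝓘(ℝ, E) γ t) (velocity 𝓘(ℝ, E) γ t) ≤ 0 := by
    intro t ht hDtne
    obtain ⟨T, hT⟩ := g.exists_timelike (γ t)
    obtain ⟨e₀, he₀on, he₀n, -⟩ := exists_orthonormal_screen (V := E) (g.val (γ t)) (hB t) (hpos t)
      hT (hnullγ t ht) (hneγ t ht)
    set eqv : ι ≃ Fin (Module.finrank ℝ E - 2) := Fintype.equivFinOfCardEq hcard' with heqv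
    set v : ι → TangentSpace 𝓘(ℝ, E) (γ t) := fun i ↦ e₀ (eqv i) with hv
    have hvon : ∀ i j, g.val (γ t) (v i) (v j) = if i = j then 1 else 0 := fun i j ↦ by
      have h := he₀on (eqv i) (eqv j)
      simp only [EmbeddingLike.apply_eq_iff_eq] at h
      exact h
    have hvn : ∀ i, g.val (γ t) (v i) (velocity 𝓘(ℝ, E) γ t) = 0 := fun i ↦ he₀n (eqv i)
    obtain ⟨φ', hφ', hle, -⟩ := raychaudhuri_gram g hreg hreg₁ hn hcard hD₀o hgeo hnullγ hneγ hJ hJd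
      hDJd hJn hDJn hW ht hDtne hvon hvn
    exact ⟨φ', hφ', hle⟩
  -- the initial value `θ(0) = θ₀`, from the frame `df_z(w)` at `γ 0 = f z`
  have hθ0 : θ 0 = θ₀ := by
    set v : ι → TangentSpace 𝓘(ℝ, E) (γ 0) := fun i ↦ mfderiv I' 𝓘(ℝ, E) f z (w i) with hv
    have hvon : ∀ i j, g.val (γ 0) (v i) (v j) = if i = j then 1 else 0 := fun i j ↦ by
      rw [hγ0]; exact hw i j
    have hvn : ∀ i, g.val (γ 0) (v i) (velocity 𝓘(ℝ, E) γ 0) = 0 := fun i ↦ by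
      rw [hv0, hγ0, g.symm]
      exact hLn z (w i)
    have hD0ne : Dt 0 ≠ 0 := by rw [hD0]; exact one_ne_zero
    obtain ⟨-, -, -, hval⟩ := raychaudhuri_gram g hreg hreg₁ hn hcard hD₀o hgeo hnullγ hneγ hJ hJd
      hDJd hJn hDJn hW h0 hD0ne hvon hvn
    have hA1 : (Matrix.of fun i k ↦ g.val (γ 0) (J k 0) (v i)) = 1 := by
      ext i k
      rw [Matrix.of_apply, hJ0 k, hv, hγ0, hw k i, Matrix.one_apply]
      by_cases hik : i = k
      · subst hik; simp
      · simp [hik, Ne.symm hik]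
    have h : θ 0 = ((Matrix.of fun i k ↦ g.val (γ 0) (covariantDerivAlong g.leviCivita γ (J k) 0)
        (v i)) * (Matrix.of fun i k ↦ g.val (γ 0) (J k 0) (v i))⁻¹).trace := hval
    rw [h, hA1, inv_one, Matrix.mul_one, Matrix.trace]
    simp only [Matrix.diag_apply, Matrix.of_apply]
    rw [← hθ₀]
    refine Finset.sum_congr rfl fun i _ ↦ ?_
    rw [← hDJ0 i, hv, hγ0]
  -- a margin beyond `T = card ι / (-θ₀)` inside the domain
  set T : ℝ := Fintype.card ι / (-θ₀) with hTdef
  have hd : (0 : ℝ) < Fintype.card ι := by exact_mod_cast Fintype.card_pos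
  have hTpos : 0 < T := div_pos hd (neg_pos.2 hneg)
  have hTD : T ∈ D₀ := hdom ⟨hTpos.le, le_rfl⟩
  obtain ⟨ε, hε, hεs⟩ := Metric.isOpen_iff.1 hD₀o T hTD
  set c : ℝ := T + ε / 2 with hcdef
  have hcD : c ∈ D₀ := hεs (by
    rw [Metric.mem_ball, Real.dist_eq, hcdef, show T + ε / 2 - T = ε / 2 by ring,
      abs_of_pos (by linarith)]
    linarith)
  have hIcc : Icc 0 c ⊆ D₀ := hD₀c.out h0 hcD
  have hTc : T < c := by rw [hcdef]; linarith
  -- Raychaudhuri comparison: `D` vanishes somewhere in `(0, T]`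
  choose! φ hφ using hstep
  have hθneg : θ 0 < 0 := by rw [hθ0]; exact hneg
  have hTθ : Fintype.card ι / (-θ 0) = T := by rw [hθ0]
  obtain ⟨tstar, htstar, hDstar⟩ := exists_eq_zero_of_raychaudhuri (D := Dt) (θ := θ) (θ' := φ)
    (c := c) hd (hDcont.mono hIcc) (by rw [hD0]; exact one_ne_zero) hθneg (by rw [hTθ]; exact hTc)
    (fun b hb hDb t ht ↦ (hφ t (hIcc ⟨ht.1, ht.2.le.trans hb⟩) (hDb t ht)).1)
    (fun b hb hDb t ht ↦ by
      have htD : t ∈ D₀ := hIcc ⟨ht.1, ht.2.le.trans hb⟩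
      have h := (hφ t htD (hDb t ht)).2
      have hR := hNEC t htD ht.1
      rw [neg_div]
      linarith)
  rw [hTθ] at htstar
  refine ⟨tstar, htstar, ?_⟩
  -- the focal point
  have htD : tstar ∈ D₀ := hdom ⟨htstar.1.le, htstar.2⟩
  obtain ⟨T', hT'⟩ := g.exists_timelike (γ tstar)
  obtain ⟨a, ha0, c', hac⟩ := exists_sum_smul_eq_smul_null_of_det_gram_eq_zero (V := E)
    (g.val (γ tstar)) (hB tstar) (hpos tstar) hT' (hnullγ tstar htD) (hneγ tstar htD)
    (J := fun k ↦ J k tstar) (fun k ↦ hJn k tstar htD) hDstar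
  set vz : TangentSpace I' z := ∑ k, a k • w k with hvz
  have hvz0 : vz ≠ 0 := by
    intro hz0
    apply ha0
    funext j
    have h := congrArg (fun u : TangentSpace I' z ↦ g.val (f z) (mfderiv I' 𝓘(ℝ, E) f z u)
      (mfderiv I' 𝓘(ℝ, E) f z (w j))) hz0
    simp only [hvz, map_sum, map_smul, FunLike.coe_sum, FunLike.coe_smul, Finset.sum_apply,
      Pi.smul_apply, smul_eq_mul, hw, mul_ite, mul_one, mul_zero, Finset.sum_ite_eq',
      Finset.mem_univ, if_true, map_zero, zero_apply] at h
    rw [Pi.zero_apply]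
    exact h
  have hker : mfderiv (I'.prod 𝓘(ℝ, ℝ)) 𝓘(ℝ, E)
      (fun q : N × ℝ ↦ expMap g.leviCivita (f q.1) (q.2 • L q.1)) (z, tstar)
      ((vz, -c') : TangentSpace (I'.prod 𝓘(ℝ, ℝ)) (z, tstar)) = 0 := by
    rw [mfderiv_normalExp_apply (cov := g.leviCivita) hL htD vz (-c')]
    have h1 : mfderiv I' 𝓘(ℝ, E) (fun z' ↦ expMap g.leviCivita (f z') (tstar • L z')) z vz =
        ∑ k, a k • J k tstar := by
      simp only [hvz, map_sum, map_smul]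
      exact Finset.sum_congr rfl fun k _ ↦ by rw [hJE k tstar htD]
    rw [h1]
    have hac' : ∑ k, a k • (J k tstar : E) = c' • (velocity 𝓘(ℝ, E) γ tstar : E) := hac
    change ∑ k, a k • (J k tstar : E) + (-c') • (velocity 𝓘(ℝ, E) γ tstar : E) = (0 : E)
    rw [hac', neg_smul]
    exact add_neg_cancel _
  intro hinj
  have hzero : ((vz, -c') : TangentSpace (I'.prod 𝓘(ℝ, ℝ)) (z, tstar)) = 0 :=
    hinj (hker.trans (map_zero _).symm)
  exact hvz0 (congrArg Prod.fst hzero)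

end Focusing



end Literature.Geometry.Lorentzian

end
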